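import Summits.PneNP.PneNP.Theorems.ChebyshevTracialDesignTightnessFree
import HarnessLib

/-!
# Cell pnp-psdrank, route `ChebyshevTracialDesign`: the crux `TracialDecayExp20` is EQUIVALENT to VIRTUAL NONNEGATIVITY OF
# UNCONSTRAINED CONTRACTION PAIRS — no tightness and no design weight in the condition (crux stmt-PneNP-19878; leaf file)

Brick 84b (prover g15). Brick 22b (`…VirtualReduction.tracialDecayExp20_iff_virtualNonneg`) states the crux as virtual nonnegativity of
TIGHT-ORTHOGONAL psd rectangles; brick 84 (`…TightnessFree.tracialDecayExp20_iff_contractions`) deletes the orthogonality clause from the crux.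
Composing the two mechanisms (the tracial degree-truncation theorem `tracial_value_truncation_explicit` / `…_of_data` uses no tightness):

  `TracialDecayExp20 ↔ ∃ a > 0, ∀ large even n, ∀ balanced B = 20 designs (t, C, w) [only the cut size t enters], ∀ r ≥ 1 with
     r²n < exp(a·dq n), ∀ families of psd CONTRACTIONS X_U, Y_M of dimension r, ∀ harmonic layer data p of the entries of X on the t-cuts:
       (1/|PM_n|)·Σ_M Σ_{|A| ≤ dq n} tr(Q_A Y_M)·knapsackMoment(|M|, t/2, |M[A]|) ≥ −(exp(−a·dq n)/2)·r`
                                                                                       (`tracialDecayExp20_iff_virtualNonneg_contractions`),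

i.e. the averaged Grigoriev pseudo-expectation `E_M Ẽ_M[tr(X^{≤D}_U Y_M)]` of the entrywise degree-`≤ dq n` truncation of an ARBITRARY
contraction-valued `X` against an ARBITRARY contraction-valued `Y` is `≥ −(e^{−aD}/2)·r` in the dimension budget. This is the form of the open
problem with every combinatorial side condition removed: no orthogonality on the tight pairs, no design weights, no level restriction — one
bilinear pseudo-expectation functional, psd contractions, a dimension budget (MEMO-18 §1–§2).
* `contractionDecay_of_virtualNonnegContr` — VIRT for contraction pairs (rate `a`) ⇒ the tightness-free decay of brick 84 (rate `a`);
* `virtualNonnegContr_of_contractionDecay` — the tightness-free decay (rate `a`) ⇒ VIRT for contraction pairs (rate `a/2`);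
* `tracialDecayExp20_iff_virtualNonneg_contractions` — the equivalence with the crux BY NAME (through brick 84).
[cite: Rothvoss2017, §2 (PDF pp. 6–8)] [cite: Grigoriev2001, Lemma 1.4 (PDF p. 8)] [cite: GriblingDelaatLaurent2019, §5]
[cite: CoppersmithRivlin1992, Thm. (p. 970)]
Stature: support/instrument (a reformulation of the OPEN crux). WHAT THIS IS NOT: no proof or refutation of the crux, nothing on psd rank of
P_PM(K_n), no P-vs-NP content.
-/

set_option linter.dupNamespace false -- `Summit.PneNP.PneNP.…`: summit = sub-problem (D-0017)

noncomputable section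

namespace Summit.PneNP.PneNP.Theorems.ChebyshevTracialDesignVirtualContractions

open Finset Matrix Polynomial Literature.Barriers.PneNP Literature.Combinatorics.Optimization Literature.Computability.Complexity
open Literature.Combinatorics.AssociationSchemes Literature.Combinatorics.AssociationSchemes.JohnsonHarmonics
open Literature.Combinatorics.AssociationSchemes.JohnsonSpectrum
open Summit.PneNP.PneNP.Theorems.ChebyshevTracialDesignLevelTail
open Summit.PneNP.PneNP.Theorems.ChebyshevTracialDesignProfilePolynomial
open Summit.PneNP.PneNP.Theorems.ChebyshevTracialDesignTracialProfilePolynomial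
open Summit.PneNP.PneNP.Theorems.ChebyshevTracialDesignVirtualValueUnique
open Summit.PneNP.PneNP.Theorems.ChebyshevTracialDesignVirtualReduction
open Summit.PneNP.PneNP.Theorems.ChebyshevTracialDesignTightnessFree
open Summit.PneNP.PneNP.Theorems.ChebyshevTracialDesignBoundedDim (le_dq_of_pow_le)

variable {n : ℕ}

/-- **VIRT for contraction pairs ⇒ tightness-free decay** (same rate). For every balanced exact design, every `r ≥ 1` in the budget and every
pair of contraction families, the design value is minus the averaged Grigoriev pseudo-expectation of the truncation up to the tail
`20·r·√P_{dq n} ≤ r·exp(−a·dq n)/2` (`tracial_value_truncation_explicit`, which uses no tightness; `sqrt_prod_atten_small`).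
[cite: Grigoriev2001, Lemma 1.4 (PDF p. 8)] [cite: Rothvoss2017, §2 (PDF pp. 6–8)] [cite: CoppersmithRivlin1992, Thm. (p. 970)] -/
theorem contractionDecay_of_virtualNonnegContr {a : ℝ} (ha : 0 < a)
    (hV : ∃ n₁ : ℕ, ∀ n : ℕ, n₁ ≤ n → Even n → ∀ (t : ℕ) (C : Finset ℕ) (w : ℕ → ℝ),
      IsBalancedDesign n t (Tq n) (dq n) 20 C w → ∀ r : ℕ, 0 < r → (r : ℝ) ^ 2 * n < Real.exp (a * (dq n : ℝ)) →
        ∀ (X : OddSet n → Matrix (Fin r) (Fin r) ℝ) (Y : PMatch n → Matrix (Fin r) (Fin r) ℝ),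
          (∀ U, (X U).PosSemidef ∧ (1 - X U).PosSemidef) → (∀ M, (Y M).PosSemidef ∧ (1 - Y M).PosSemidef) →
          ∀ p : Fin r × Fin r → ℕ → Finset (Fin n) → ℝ, (∀ ab j, IsHarmonic j (p ab j)) →
            (∀ ab (U : OddSet n), U.1.card = t →
              X U ab.1 ab.2 = (∑ j ∈ range (t + 1), up^[t - j] (p ab j)) U.1) →
            -(Real.exp (-(a * (dq n : ℝ))) / 2 * r) ≤
              (Fintype.card (PMatch n) : ℝ)⁻¹ * ∑ M : PMatch n, ∑ A : {A : Finset (Fin n) // A.card ≤ dq n},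
                (Matrix.of (fun a' b' : Fin r =>
                  (∑ j ∈ range (t + 1), ((t - j).factorial : ℝ) • (if dq n < j then 0 else p (a', b') j)) A.1) *
                    Y M).trace *
                  knapsackMoment M.1.card ((t : ℝ) / 2) (M.1.filter fun e => ∃ v ∈ A.1, v ∈ e).card) :
    ∃ n₁ : ℕ, ∀ n : ℕ, n₁ ≤ n → Even n → ∀ (t : ℕ) (C : Finset ℕ) (w : ℕ → ℝ),
      IsBalancedDesign n t (Tq n) (dq n) 20 C w → ∀ r : ℕ, 0 < r → (r : ℝ) ^ 2 * n < Real.exp (a * (dq n : ℝ)) →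
        ∀ (X : OddSet n → Matrix (Fin r) (Fin r) ℝ) (Y : PMatch n → Matrix (Fin r) (Fin r) ℝ),
          (∀ U, (X U).PosSemidef ∧ (1 - X U).PosSemidef) → (∀ M, (Y M).PosSemidef ∧ (1 - Y M).PosSemidef) →
            (∑ U, ∑ M, levelWeight n t C w U M * (X U * Y M).trace) / r ≤ Real.exp (-(a * (dq n : ℝ))) := by
  obtain ⟨n₁, hn₁⟩ := hV
  obtain ⟨n₀, hn₀⟩ := sqrt_prod_atten_small ha
  refine ⟨max n₀ n₁, fun n hn hev t C w hdes r hr hbud X Y hX hY => ?_⟩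
  have hn0 : n₀ ≤ n := le_trans (le_max_left _ _) hn
  have hn1 : n₁ ≤ n := le_trans (le_max_right _ _) hn
  obtain ⟨-, htail⟩ := hn₀ n hn0
  have hex : IsExactDesign n t (Tq n) (dq n) 20 C w := hdes.1
  obtain ⟨c', rfl⟩ : ∃ c', t = 2 * c' + 1 := hex.1
  have ht : 2 * (2 * c' + 1) + 2 ≤ n := hex.2.1
  have hD : dq n ≤ 2 * c' := by
    have h1 := dq_add_three_le_Tq n
    have h2 : Tq n ≤ 2 * c' + 1 := hex.2.2.1
    omega
  have hB := hex.2.2.2.2.2.2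
  obtain ⟨p, hp, hpdec, hbound⟩ := tracial_value_truncation_explicit hev hex hD X Y
  have hv := hn₁ n hn1 hev (2 * c' + 1) C w hdes r hr hbud X Y hX hY p hp hpdec
  have hPm : (0 : ℝ) < Fintype.card (PMatch n) := by exact_mod_cast card_pmatch_pos hev
  have hCn : (0 : ℝ) < n.choose (2 * c' + 1) := by exact_mod_cast Nat.choose_pos (by omega)
  have hPD := prod_atten_nonneg (n := n) (K := dq n) (by omega)
  have htl := sqrt_tail_le_of_le hPD hCn hPm (Nat.cast_nonneg r)
    (sum_nonneg fun M _ => by positivity) (sum_frobenius_cuts_le ⟨c', rfl⟩ hX) (sum_frobenius_matchings_le hY)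
  have hw0 : 0 ≤ ∑ c ∈ C, |w c| := sum_nonneg fun c _ => abs_nonneg _
  have hr' : (0 : ℝ) < r := by exact_mod_cast hr
  rw [div_le_iff₀ hr']
  have h1 := (abs_le.1 hbound).2
  have h2 : (∑ c ∈ C, |w c|) *
      Real.sqrt ((∏ i ∈ range (dq n / 2 + 1), ((2 * i + 1 : ℝ) / ((n : ℝ) - 2 * i))) *
        ((∑ U : OddSet n, if U.1.card = 2 * c' + 1 then ∑ a, ∑ b, X U a b ^ 2 else 0) / (n.choose (2 * c' + 1) : ℝ)) *
        ((∑ M : PMatch n, ∑ a, ∑ b, Y M a b ^ 2) / (Fintype.card (PMatch n) : ℝ))) ≤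
      20 * ((r : ℝ) * Real.sqrt (∏ i ∈ range (dq n / 2 + 1), ((2 * i + 1 : ℝ) / ((n : ℝ) - 2 * i)))) :=
    mul_le_mul hB htl (Real.sqrt_nonneg _) (by norm_num)
  have htail' : 20 * ((r : ℝ) * Real.sqrt (∏ i ∈ range (dq n / 2 + 1), ((2 * i + 1 : ℝ) / ((n : ℝ) - 2 * i)))) ≤
      (r : ℝ) * (Real.exp (-(a * (dq n : ℝ))) / 2) := by
    have := mul_le_mul_of_nonneg_left htail hr'.le
    linarith
  nlinarith [h1, h2, hv, htail', hr'.le, Real.exp_pos (-(a * (dq n : ℝ)))]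

/-- **Tightness-free decay ⇒ VIRT for contraction pairs** (rate `a ↦ a/2`): for every harmonic datum the averaged pseudo-expectation is minus
the design value up to the tail (`tracial_value_truncation_of_data`, no tightness), and `e^{−aD} + e^{−aD}/2 ≤ … ≤ e^{−(a/2)D}/2` once
`a·dq n ≥ 4`. [cite: Grigoriev2001, Lemma 1.4 (PDF p. 8)] [cite: Rothvoss2017, §2 (PDF pp. 6–8)] [cite: CoppersmithRivlin1992, Thm. (p. 970)] -/
theorem virtualNonnegContr_of_contractionDecay {a : ℝ} (ha : 0 < a)
    (h : ∃ n₁ : ℕ, ∀ n : ℕ, n₁ ≤ n → Even n → ∀ (t : ℕ) (C : Finset ℕ) (w : ℕ → ℝ),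
      IsBalancedDesign n t (Tq n) (dq n) 20 C w → ∀ r : ℕ, 0 < r → (r : ℝ) ^ 2 * n < Real.exp (a * (dq n : ℝ)) →
        ∀ (X : OddSet n → Matrix (Fin r) (Fin r) ℝ) (Y : PMatch n → Matrix (Fin r) (Fin r) ℝ),
          (∀ U, (X U).PosSemidef ∧ (1 - X U).PosSemidef) → (∀ M, (Y M).PosSemidef ∧ (1 - Y M).PosSemidef) →
            (∑ U, ∑ M, levelWeight n t C w U M * (X U * Y M).trace) / r ≤ Real.exp (-(a * (dq n : ℝ)))) :
    ∃ n₁ : ℕ, ∀ n : ℕ, n₁ ≤ n → Even n → ∀ (t : ℕ) (C : Finset ℕ) (w : ℕ → ℝ),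
      IsBalancedDesign n t (Tq n) (dq n) 20 C w → ∀ r : ℕ, 0 < r → (r : ℝ) ^ 2 * n < Real.exp (a / 2 * (dq n : ℝ)) →
        ∀ (X : OddSet n → Matrix (Fin r) (Fin r) ℝ) (Y : PMatch n → Matrix (Fin r) (Fin r) ℝ),
          (∀ U, (X U).PosSemidef ∧ (1 - X U).PosSemidef) → (∀ M, (Y M).PosSemidef ∧ (1 - Y M).PosSemidef) →
          ∀ p : Fin r × Fin r → ℕ → Finset (Fin n) → ℝ, (∀ ab j, IsHarmonic j (p ab j)) →
            (∀ ab (U : OddSet n), U.1.card = t →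
              X U ab.1 ab.2 = (∑ j ∈ range (t + 1), up^[t - j] (p ab j)) U.1) →
            -(Real.exp (-(a / 2 * (dq n : ℝ))) / 2 * r) ≤
              (Fintype.card (PMatch n) : ℝ)⁻¹ * ∑ M : PMatch n, ∑ A : {A : Finset (Fin n) // A.card ≤ dq n},
                (Matrix.of (fun a' b' : Fin r =>
                  (∑ j ∈ range (t + 1), ((t - j).factorial : ℝ) • (if dq n < j then 0 else p (a', b') j)) A.1) *
                    Y M).trace *
                  knapsackMoment M.1.card ((t : ℝ) / 2) (M.1.filter fun e => ∃ v ∈ A.1, v ∈ e).card := by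
  obtain ⟨n₁, hn₁⟩ := h
  obtain ⟨n₀, hn₀⟩ := sqrt_prod_atten_small ha
  obtain ⟨D₀, hD₀⟩ := exists_nat_ge (4 / a)
  refine ⟨max (max n₀ n₁) (D₀ ^ 4), fun n hn hev t C w hdes r hr hbud X Y hX hY p hp hpdec => ?_⟩
  have hn0 : n₀ ≤ n := le_trans (le_trans (le_max_left _ _) (le_max_left _ _)) hn
  have hn1 : n₁ ≤ n := le_trans (le_trans (le_max_right _ _) (le_max_left _ _)) hn
  have hnD : D₀ ^ 4 ≤ n := le_trans (le_max_right _ _) hn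
  have hDD : D₀ ≤ dq n := le_dq_of_pow_le hnD
  obtain ⟨-, htail⟩ := hn₀ n hn0
  have hex : IsExactDesign n t (Tq n) (dq n) 20 C w := hdes.1
  obtain ⟨c', rfl⟩ : ∃ c', t = 2 * c' + 1 := hex.1
  have ht : 2 * (2 * c' + 1) + 2 ≤ n := hex.2.1
  have hD : dq n ≤ 2 * c' := by
    have h1 := dq_add_three_le_Tq n
    have h2 : Tq n ≤ 2 * c' + 1 := hex.2.2.1
    omega
  have hB := hex.2.2.2.2.2.2
  have hDnn : (0 : ℝ) ≤ (dq n : ℝ) := Nat.cast_nonneg _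
  have hbud' : (r : ℝ) ^ 2 * n < Real.exp (a * (dq n : ℝ)) :=
    hbud.trans_le (Real.exp_le_exp.2 (by nlinarith))
  have hval := hn₁ n hn1 hev (2 * c' + 1) C w hdes r hr hbud' X Y hX hY
  have hr' : (0 : ℝ) < r := by exact_mod_cast hr
  have hvalue : ∑ U : OddSet n, ∑ M : PMatch n, levelWeight n (2 * c' + 1) C w U M * (X U * Y M).trace ≤
      (r : ℝ) * Real.exp (-(a * (dq n : ℝ))) := by
    have := (div_le_iff₀ hr').1 hval
    linarith
  have htr := tracial_value_truncation_of_data hev hex hD X Y p hp hpdec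
  have hPm : (0 : ℝ) < Fintype.card (PMatch n) := by exact_mod_cast card_pmatch_pos hev
  have hCn : (0 : ℝ) < n.choose (2 * c' + 1) := by exact_mod_cast Nat.choose_pos (by omega)
  have hPD := prod_atten_nonneg (n := n) (K := dq n) (by omega)
  have htl := sqrt_tail_le_of_le hPD hCn hPm (Nat.cast_nonneg r)
    (sum_nonneg fun M _ => by positivity) (sum_frobenius_cuts_le ⟨c', rfl⟩ hX) (sum_frobenius_matchings_le hY)
  have hw0 : 0 ≤ ∑ c ∈ C, |w c| := sum_nonneg fun c _ => abs_nonneg _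
  have h1 := (abs_le.1 htr).1
  have h2 : (∑ c ∈ C, |w c|) *
      Real.sqrt ((∏ i ∈ range (dq n / 2 + 1), ((2 * i + 1 : ℝ) / ((n : ℝ) - 2 * i))) *
        ((∑ U : OddSet n, if U.1.card = 2 * c' + 1 then ∑ a, ∑ b, X U a b ^ 2 else 0) / (n.choose (2 * c' + 1) : ℝ)) *
        ((∑ M : PMatch n, ∑ a, ∑ b, Y M a b ^ 2) / (Fintype.card (PMatch n) : ℝ))) ≤
      20 * ((r : ℝ) * Real.sqrt (∏ i ∈ range (dq n / 2 + 1), ((2 * i + 1 : ℝ) / ((n : ℝ) - 2 * i)))) :=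
    mul_le_mul hB htl (Real.sqrt_nonneg _) (by norm_num)
  have h3 : 3 * Real.exp (-(a * (dq n : ℝ))) ≤ Real.exp (-(a / 2 * (dq n : ℝ))) := by
    refine three_mul_exp_le ?_
    have : (4 : ℝ) / a ≤ (dq n : ℝ) := hD₀.trans (by exact_mod_cast hDD)
    have h4 : 4 ≤ a * (dq n : ℝ) := by
      have := mul_le_mul_of_nonneg_left this ha.le
      rwa [mul_div_cancel₀ _ ha.ne'] at this
    linarith
  have htail' : 20 * ((r : ℝ) * Real.sqrt (∏ i ∈ range (dq n / 2 + 1), ((2 * i + 1 : ℝ) / ((n : ℝ) - 2 * i)))) ≤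
      (r : ℝ) * (Real.exp (-(a * (dq n : ℝ))) / 2) := by
    have := mul_le_mul_of_nonneg_left htail hr'.le
    linarith
  nlinarith [h1, h2, h3, htail', hvalue, hr'.le, Real.exp_pos (-(a * (dq n : ℝ)))]

/-- **THE CRUX IS VIRTUAL NONNEGATIVITY OF UNCONSTRAINED CONTRACTION PAIRS.** `TracialDecayExp20` holds iff for some `a > 0` and all large even
`n`, for every balanced `B = 20` design (only its cut size `t` enters), every `r ≥ 1` with `r²n < exp(a·dq n)`, every pair of families of
psd contractions `0 ⪯ X_U, Y_M ⪯ I_r` (NO orthogonality on the tight pairs) and every harmonic layer datum of the entries of `X` on the `t`-cuts,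
the averaged Grigoriev pseudo-expectation of `tr(X^{≤ dq n}_U Y_M)` is `≥ −(exp(−a·dq n)/2)·r`.
[cite: Rothvoss2017, §2 (PDF pp. 6–8)] [cite: Grigoriev2001, Lemma 1.4 (PDF p. 8)] [cite: GriblingDelaatLaurent2019, §5]
[cite: CoppersmithRivlin1992, Thm. (p. 970)] -/
theorem tracialDecayExp20_iff_virtualNonneg_contractions :
    Summit.PneNP.PneNP.Theses.ChebyshevTracialDesign.TracialDecayExp20 ↔
    ∃ a : ℝ, 0 < a ∧ ∃ n₁ : ℕ, ∀ n : ℕ, n₁ ≤ n → Even n → ∀ (t : ℕ) (C : Finset ℕ) (w : ℕ → ℝ),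
      IsBalancedDesign n t (Tq n) (dq n) 20 C w → ∀ r : ℕ, 0 < r → (r : ℝ) ^ 2 * n < Real.exp (a * (dq n : ℝ)) →
        ∀ (X : OddSet n → Matrix (Fin r) (Fin r) ℝ) (Y : PMatch n → Matrix (Fin r) (Fin r) ℝ),
          (∀ U, (X U).PosSemidef ∧ (1 - X U).PosSemidef) → (∀ M, (Y M).PosSemidef ∧ (1 - Y M).PosSemidef) →
          ∀ p : Fin r × Fin r → ℕ → Finset (Fin n) → ℝ, (∀ ab j, IsHarmonic j (p ab j)) →
            (∀ ab (U : OddSet n), U.1.card = t →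
              X U ab.1 ab.2 = (∑ j ∈ range (t + 1), up^[t - j] (p ab j)) U.1) →
            -(Real.exp (-(a * (dq n : ℝ))) / 2 * r) ≤
              (Fintype.card (PMatch n) : ℝ)⁻¹ * ∑ M : PMatch n, ∑ A : {A : Finset (Fin n) // A.card ≤ dq n},
                (Matrix.of (fun a' b' : Fin r =>
                  (∑ j ∈ range (t + 1), ((t - j).factorial : ℝ) • (if dq n < j then 0 else p (a', b') j)) A.1) *
                    Y M).trace *
                  knapsackMoment M.1.card ((t : ℝ) / 2) (M.1.filter fun e => ∃ v ∈ A.1, v ∈ e).card := by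
  constructor
  · intro hcrux
    obtain ⟨a, ha, hdec⟩ := contractionDecay_of_tracialDecayExp20 hcrux
    exact ⟨a / 2, by positivity, virtualNonnegContr_of_contractionDecay ha hdec⟩
  · rintro ⟨a, ha, hV⟩
    exact tracialDecayExp20_of_contractionDecay ⟨a, ha, contractionDecay_of_virtualNonnegContr ha hV⟩

end Summit.PneNP.PneNP.Theorems.ChebyshevTracialDesignVirtualContractions

end
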